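import Summits.BirchSwinnertonDyer.Rank1Residual.ManinAdditive.TowerRigidity
import HarnessLib

/-!
# E-an-142 in the tree, part 1: LEMMA A (hub periodicity) from the invariance rows `(∗ ∗; N k, qʲ)` — PROOFS-an-72 §5 (5.1)

Summit `BirchSwinnertonDyer`, route `ManinLocalTwoThree` (cell bsd-f2-manin), cruxes C2 `ManinOddAtFour` (stmt-BirchSwinnertonDyer-22967) /
C3 `ManinPrimeToThreeAtNine` (stmt-…-22968) through the tower input E-an-135 ⟸ E-an-142 (`TowerExtension.TVPatternRigidity`, typer p672452) ⟸
LEMMA MH (`TowerExtension.MultiHubRigid`, p2's theorem `multiHubRigidLaw`, p675082) via the obligation node `TowerExtension.MultiHubImpliesRigidity`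
(typer p674557).  Prover seat bsd-line-manin23-p1 (C2/C3 LEAD), gen 10.

This file PORTS, BY VALUE and with UNBUNDLED hypotheses (no new definitions), the LEMMA-A block of the an planner's L9 skeleton
`HOME/an/g30/TowerRigiditySkeleton-an-g30.lean` (an g30, kernel-checked there against a bundling structure `TVHyp` and an explicit-matrix
`def mkSL`, neither of which is a tree object): the hypotheses are the binders of `TVPatternRigidity N q p` — `level0` (P0), `period` (P1),
`even` (EV), `inv` (Γ₀(N)-invariance rows) — passed explicitly, and explicit matrices are replaced by «any `γ ∈ SL₂(ℤ)` with the given bottom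
row» (`exists_SL2_of_det` supplies one).

* `periodZ`, `of_shift` (integer periods), `units_arg` (signs invisible), `isCoprime_q_Nk`, `exists_SL2_of_det`, `SL_det_entries`, `units_sq_int`;
* `lemmaA_core` — for `γ` with bottom row `(Nk, qʲ)`: `c γ = g j ρ` (`ρ` a `q`-adic inverse of `Nk` to precision `q^L`, `j ≤ L`);
* `lemmaA_inst0` — same `γ`, `qʲ ≡ ε q^{j'} (mod Nk)`: `c γ = g j' ρ`;  `lemmaA_insti` — `q^{i+j} ≡ ε (mod Nk)`: `c γ = −g i ρ`;
* `lemmaA_eq` / `lemmaA_neg` — **LEMMA A** (5.1): the hub profile `j ↦ g j ρ` is `o_k`-periodic and odd under `j ↦ −j`;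
* `resAll`, `of_shift_res`, `isCoprime_rho`, `isCoprime_diag` — bookkeeping for the deep rows (part 2).

HONEST FRAMING: bookkeeping lemmas toward `MultiHubImpliesRigidity`; nothing here is a law; E-an-142, E-an-135, C2, C3, Manin's conjecture and
BSD are NOT proved by this file.  Credits: statements and proofs are the an planner's (skeleton sha16 60268fc1e4a910cb), re-keyed to tree binders.
-/

set_option autoImplicit false
set_option linter.dupNamespace false

namespace Summit.BirchSwinnertonDyer.BirchSwinnertonDyer.Theorems.ManinLocalTwoThree.TVRigidity

open Matrix
open scoped MatrixGroups

variable {N q p s : ℕ} {g : ℕ → ℤ → ZMod p} {c : SL(2, ℤ) → ZMod p}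

/-! ### §1. Periods, signs, explicit rows -/

/-- Period `qⁿ` at level `n`, integer multiples (from (P1)). [folklore] -/
theorem periodZ (period : ∀ (n : ℕ) (r : ℤ), g n (r + (q : ℤ) ^ n) = g n r) (n : ℕ) (r t : ℤ) :
    g n (r + t * (q : ℤ) ^ n) = g n r := by
  induction t using Int.induction_on generalizing r with
  | zero => simp
  | succ k ih =>
      have e1 : r + ((k : ℤ) + 1) * (q : ℤ) ^ n = (r + (k : ℤ) * (q : ℤ) ^ n) + (q : ℤ) ^ n := by ring
      rw [e1, period, ih]
  | pred k ih =>
      have e1 : r + (-(k : ℤ)) * (q : ℤ) ^ n = (r + (-(k : ℤ) - 1) * (q : ℤ) ^ n) + (q : ℤ) ^ n := by ring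
      have := period n (r + (-(k : ℤ) - 1) * (q : ℤ) ^ n)
      rw [← e1, ih] at this
      exact this.symm

/-- Values at a level only depend on the argument modulo `qⁿ` (explicit form). [folklore] -/
theorem of_shift (period : ∀ (n : ℕ) (r : ℤ), g n (r + (q : ℤ) ^ n) = g n r) (n : ℕ) {x y : ℤ} (T : ℤ)
    (h : x = y + T * (q : ℤ) ^ n) : g n x = g n y := by
  rw [h]; exact periodZ period n y T

/-- Signs are invisible (evenness (EV)). [folklore] -/
theorem units_arg (even : ∀ (n : ℕ) (r : ℤ), g n (-r) = g n r) (n : ℕ) (ε : ℤˣ) (x : ℤ) :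
    g n ((ε : ℤ) * x) = g n x := by
  rcases Int.units_eq_one_or ε with h | h
  · simp [h]
  · simp [h, even]

/-- `q` is prime to `N·k` for `k` prime to `q` (`q` prime, `q ∤ p·N`). [folklore] -/
theorem isCoprime_q_Nk (hq : q.Prime) (hqpN : ¬ q ∣ p * N) (k : ℕ) (hkq : Nat.Coprime k q) :
    IsCoprime (q : ℤ) ((N * k : ℕ) : ℤ) := by
  have hqN : Nat.Coprime q N := (Nat.Prime.coprime_iff_not_dvd hq).mpr (fun h => hqpN (dvd_mul_of_dvd_right h p))
  have : Nat.Coprime q (N * k) := Nat.Coprime.mul_right hqN hkq.symm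
  exact_mod_cast Nat.Coprime.isCoprime this

/-- An element of `SL(2, ℤ)` with prescribed entries of determinant `1`. [folklore] -/
theorem exists_SL2_of_det (A B C D : ℤ) (h : A * D - B * C = 1) :
    ∃ γ : SL(2, ℤ), (γ : Matrix (Fin 2) (Fin 2) ℤ) 0 0 = A ∧ (γ : Matrix (Fin 2) (Fin 2) ℤ) 0 1 = B ∧
      (γ : Matrix (Fin 2) (Fin 2) ℤ) 1 0 = C ∧ (γ : Matrix (Fin 2) (Fin 2) ℤ) 1 1 = D :=
  ⟨⟨!![A, B; C, D], by rw [Matrix.det_fin_two_of]; exact h⟩, rfl, rfl, rfl, rfl⟩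

/-- The determinant of `γ : SL(2, ℤ)` in entries. [folklore] -/
theorem SL_det_entries (γ : SL(2, ℤ)) :
    (γ : Matrix (Fin 2) (Fin 2) ℤ) 0 0 * (γ : Matrix (Fin 2) (Fin 2) ℤ) 1 1 -
      (γ : Matrix (Fin 2) (Fin 2) ℤ) 0 1 * (γ : Matrix (Fin 2) (Fin 2) ℤ) 1 0 = 1 := by
  have := γ.prop
  rw [Matrix.det_fin_two] at this
  exact this

/-- `ε² = 1` for `ε : ℤˣ`. [folklore] -/
theorem units_sq_int (ε : ℤˣ) : (ε : ℤ) * (ε : ℤ) = 1 := by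
  rcases Int.units_eq_one_or ε with h | h <;> simp [h]

/-! ### §2. LEMMA A: the rows `(A B; N k, qʲ)` -/

section LemmaA

variable (level0 : ∀ r : ℤ, g 0 r = 0)
  (period : ∀ (n : ℕ) (r : ℤ), g n (r + (q : ℤ) ^ n) = g n r)
  (even : ∀ (n : ℕ) (r : ℤ), g n (-r) = g n r)
  (inv : ∀ γ : SL(2, ℤ), (N : ℤ) ∣ (γ : Matrix (Fin 2) (Fin 2) ℤ) 1 0 →
    ∀ (r : ℤ) (i j : ℕ) (ε : ℤˣ),
      (γ : Matrix (Fin 2) (Fin 2) ℤ) 1 0 * r + (γ : Matrix (Fin 2) (Fin 2) ℤ) 1 1 * (q : ℤ) ^ i = (ε : ℤ) * (q : ℤ) ^ j →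
      g j ((ε : ℤ) * ((γ : Matrix (Fin 2) (Fin 2) ℤ) 0 0 * r + (γ : Matrix (Fin 2) (Fin 2) ℤ) 0 1 * (q : ℤ) ^ i)) - g i r = c γ)

include level0 period even inv in
/-- **LEMMA A, core** (PROOFS-an-72 §5 (5.1), instance `i = 0`, `r = 0`): for `γ ∈ SL₂(ℤ)` with bottom row `(N k, qʲ)` the cocycle value is the
hub value, `c γ = g j ρ`, where `Nk·ρ ≡ 1 (mod q^L)`, `j ≤ L`. -/
theorem lemmaA_core (k L : ℕ) (ρ : ℤ) (hρ : ((N * k : ℕ) : ℤ) * ρ ≡ 1 [ZMOD (q : ℤ) ^ L]) (j : ℕ) (hj : j ≤ L)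
    (γ : SL(2, ℤ)) (hC : (γ : Matrix (Fin 2) (Fin 2) ℤ) 1 0 = ((N * k : ℕ) : ℤ))
    (hD : (γ : Matrix (Fin 2) (Fin 2) ℤ) 1 1 = (q : ℤ) ^ j) : c γ = g j ρ := by
  have hdet := SL_det_entries γ
  rw [hC, hD] at hdet
  have h1 := inv γ (by rw [hC]; push_cast; exact dvd_mul_right _ _) 0 0 j 1 (by rw [hC, hD]; simp)
  simp only [Units.val_one, one_mul, mul_zero, pow_zero, mul_one, zero_add, level0, sub_zero] at h1
  rw [← h1]
  obtain ⟨w, hw⟩ := hρ.dvd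
  have hL : (q : ℤ) ^ L = (q : ℤ) ^ j * (q : ℤ) ^ (L - j) := by rw [← pow_add, Nat.add_sub_cancel' hj]
  have e1 : (γ : Matrix (Fin 2) (Fin 2) ℤ) 0 1 =
      -ρ + ((γ : Matrix (Fin 2) (Fin 2) ℤ) 0 0 * ρ + (γ : Matrix (Fin 2) (Fin 2) ℤ) 0 1 * w * (q : ℤ) ^ (L - j)) * (q : ℤ) ^ j := by
    linear_combination (-ρ) * hdet + ((γ : Matrix (Fin 2) (Fin 2) ℤ) 0 1) * hw + ((γ : Matrix (Fin 2) (Fin 2) ℤ) 0 1 * w) * hL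
  rw [of_shift period j _ e1, even]

include level0 period even inv in
/-- **LEMMA A, second instance `i = 0`** at level `j'` with `qʲ ≡ ε q^{j'} (mod Nk)`: the same cocycle value is `g j' ρ`. -/
theorem lemmaA_inst0 (k L : ℕ) (ρ : ℤ) (hρ : ((N * k : ℕ) : ℤ) * ρ ≡ 1 [ZMOD (q : ℤ) ^ L]) (j : ℕ)
    (γ : SL(2, ℤ)) (hC : (γ : Matrix (Fin 2) (Fin 2) ℤ) 1 0 = ((N * k : ℕ) : ℤ))
    (hD : (γ : Matrix (Fin 2) (Fin 2) ℤ) 1 1 = (q : ℤ) ^ j) (j' : ℕ) (hj' : j' ≤ L) (ε : ℤˣ)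
    (hq : ((q : ℤ)) ^ j ≡ (ε : ℤ) * (q : ℤ) ^ j' [ZMOD ((N * k : ℕ) : ℤ)]) : c γ = g j' ρ := by
  have hdet := SL_det_entries γ
  rw [hC, hD] at hdet
  obtain ⟨r', hr'⟩ := hq.dvd
  have h1 := inv γ (by rw [hC]; push_cast; exact dvd_mul_right _ _) r' 0 j' ε
    (by rw [hC, hD, pow_zero, mul_one]; linear_combination -hr')
  simp only [pow_zero, mul_one, level0, sub_zero] at h1
  rw [← h1, units_arg even]
  obtain ⟨w, hw⟩ := hρ.dvd
  have hL : (q : ℤ) ^ L = (q : ℤ) ^ j' * (q : ℤ) ^ (L - j') := by rw [← pow_add, Nat.add_sub_cancel' hj']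
  set A := (γ : Matrix (Fin 2) (Fin 2) ℤ) 0 0
  set B := (γ : Matrix (Fin 2) (Fin 2) ℤ) 0 1
  have hX : ((N * k : ℕ) : ℤ) * (A * r' + B) = A * (ε : ℤ) * (q : ℤ) ^ j' - 1 := by
    linear_combination A * hr'.symm - hdet
  have e1 : A * r' + B = -ρ + (A * (ε : ℤ) * ρ + (A * r' + B) * w * (q : ℤ) ^ (L - j')) * (q : ℤ) ^ j' := by
    linear_combination ρ * hX + (A * r' + B) * hw + ((A * r' + B) * w) * hL
  rw [of_shift period j' _ e1, even]

include level0 period even inv in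
/-- **LEMMA A, instance `i ≥ 1`, `j₂ = 0`** with `q^{i+j} ≡ ε (mod Nk)`: the same cocycle value is `−g i ρ`. -/
theorem lemmaA_insti (k L : ℕ) (ρ : ℤ) (hρ : ((N * k : ℕ) : ℤ) * ρ ≡ 1 [ZMOD (q : ℤ) ^ L]) (j : ℕ)
    (γ : SL(2, ℤ)) (hC : (γ : Matrix (Fin 2) (Fin 2) ℤ) 1 0 = ((N * k : ℕ) : ℤ))
    (hD : (γ : Matrix (Fin 2) (Fin 2) ℤ) 1 1 = (q : ℤ) ^ j) (i : ℕ) (hiL : i ≤ L) (ε : ℤˣ)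
    (hq : ((q : ℤ)) ^ (i + j) ≡ (ε : ℤ) [ZMOD ((N * k : ℕ) : ℤ)]) : c γ = - g i ρ := by
  have hdet := SL_det_entries γ
  rw [hC, hD] at hdet
  obtain ⟨r, hr⟩ := hq.dvd
  have hij : (q : ℤ) ^ (i + j) = (q : ℤ) ^ i * (q : ℤ) ^ j := pow_add _ _ _
  have h1 := inv γ (by rw [hC]; push_cast; exact dvd_mul_right _ _) r i 0 ε
    (by rw [hC, hD, pow_zero, mul_one]; linear_combination -hr - hij)
  simp only [level0, zero_sub] at h1
  rw [← h1, neg_inj]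
  obtain ⟨w, hw⟩ := hρ.dvd
  have hL : (q : ℤ) ^ L = (q : ℤ) ^ i * (q : ℤ) ^ (L - i) := by rw [← pow_add, Nat.add_sub_cancel' hiL]
  have e1 : r = (ε : ℤ) * ρ + (-(ρ * (q : ℤ) ^ j) + r * w * (q : ℤ) ^ (L - i)) * (q : ℤ) ^ i := by
    linear_combination (-ρ) * hr + r * hw - ρ * hij + (r * w) * hL
  rw [of_shift period i _ e1, units_arg even]

include level0 period even inv in
/-- **LEMMA A, equality form** (PROOFS-an-72 §5 (5.1)): `qʲ ≡ ε q^{j'} (mod Nk)` ⟹ `g j ρ = g j' ρ` — the hub profile is `o_k`-periodic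
(`q` prime, `q ∤ p·N`, `k` prime to `q`; `ρ` a `q`-adic inverse of `Nk` to precision `q^L`, `j, j' ≤ L`). -/
theorem lemmaA_eq (hq0 : q.Prime) (hqpN : ¬ q ∣ p * N) (k L : ℕ) (hkq : Nat.Coprime k q) (ρ : ℤ)
    (hρ : ((N * k : ℕ) : ℤ) * ρ ≡ 1 [ZMOD (q : ℤ) ^ L]) (j j' : ℕ) (hj : j ≤ L) (hj' : j' ≤ L) (ε : ℤˣ)
    (hq : ((q : ℤ)) ^ j ≡ (ε : ℤ) * (q : ℤ) ^ j' [ZMOD ((N * k : ℕ) : ℤ)]) : g j ρ = g j' ρ := by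
  obtain ⟨u, v, huv⟩ := (isCoprime_q_Nk hq0 hqpN k hkq).pow_left (m := j)
  obtain ⟨γ, -, -, hC, hD⟩ := exists_SL2_of_det u (-v) ((N * k : ℕ) : ℤ) ((q : ℤ) ^ j) (by linear_combination huv)
  rw [← lemmaA_core level0 period even inv k L ρ hρ j hj γ hC hD,
    lemmaA_inst0 level0 period even inv k L ρ hρ j γ hC hD j' hj' ε hq]

include level0 period even inv in
/-- **LEMMA A, sign form** (5.1): `q^{i+j} ≡ ε (mod Nk)` ⟹ `g j ρ = −g i ρ`; in particular `qʲ ≡ ±1 ⟹ g j ρ = 0`. -/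
theorem lemmaA_neg (hq0 : q.Prime) (hqpN : ¬ q ∣ p * N) (k L : ℕ) (hkq : Nat.Coprime k q) (ρ : ℤ)
    (hρ : ((N * k : ℕ) : ℤ) * ρ ≡ 1 [ZMOD (q : ℤ) ^ L]) (i j : ℕ) (hiL : i ≤ L) (hjL : j ≤ L) (ε : ℤˣ)
    (hq : ((q : ℤ)) ^ (i + j) ≡ (ε : ℤ) [ZMOD ((N * k : ℕ) : ℤ)]) : g j ρ = - g i ρ := by
  obtain ⟨u, v, huv⟩ := (isCoprime_q_Nk hq0 hqpN k hkq).pow_left (m := j)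
  obtain ⟨γ, -, -, hC, hD⟩ := exists_SL2_of_det u (-v) ((N * k : ℕ) : ℤ) ((q : ℤ) ^ j) (by linear_combination huv)
  rw [← lemmaA_core level0 period even inv k L ρ hρ j hjL γ hC hD,
    lemmaA_insti level0 period even inv k L ρ hρ j γ hC hD i hiL ε hq]

end LemmaA

/-! ### §3. Bookkeeping for the deep rows -/

/-- Resolution at every level (below `s` the exact period `qⁿ` is finer than `qˢ`). [folklore] -/
theorem resAll (period : ∀ (n : ℕ) (r : ℤ), g n (r + (q : ℤ) ^ n) = g n r)
    (hres : ∀ (n : ℕ) (r t : ℤ), s ≤ n → IsCoprime r (q : ℤ) → g n (r + t * (q : ℤ) ^ s) = g n r)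
    (n : ℕ) (r t : ℤ) (hr : IsCoprime r (q : ℤ)) : g n (r + t * (q : ℤ) ^ s) = g n r := by
  by_cases hn : s ≤ n
  · exact hres n r t hn hr
  · have e1 : r + t * (q : ℤ) ^ s = r + (t * (q : ℤ) ^ (s - n)) * (q : ℤ) ^ n := by
      rw [mul_assoc, ← pow_add, Nat.sub_add_cancel (by omega)]
    rw [e1, periodZ period]

/-- `of_shift` at precision `qˢ` on units. [folklore] -/
theorem of_shift_res (period : ∀ (n : ℕ) (r : ℤ), g n (r + (q : ℤ) ^ n) = g n r)
    (hres : ∀ (n : ℕ) (r t : ℤ), s ≤ n → IsCoprime r (q : ℤ) → g n (r + t * (q : ℤ) ^ s) = g n r)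
    (n : ℕ) {x y : ℤ} (T : ℤ) (hy : IsCoprime y (q : ℤ)) (h : x = y + T * (q : ℤ) ^ s) : g n x = g n y := by
  rw [h]; exact resAll period hres n y T hy

/-- `ρ` is prime to `q` when `M·ρ ≡ 1 (mod q^L)`, `L ≥ 1`. [folklore] -/
theorem isCoprime_rho {M : ℤ} {ρ : ℤ} {L : ℕ} (hL : 1 ≤ L) (hρ : M * ρ ≡ 1 [ZMOD (q : ℤ) ^ L]) :
    IsCoprime ρ (q : ℤ) := by
  obtain ⟨w, hw⟩ := hρ.dvd
  refine ⟨M, (q : ℤ) ^ (L - 1) * w, ?_⟩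
  have hL' : (q : ℤ) ^ L = (q : ℤ) ^ (L - 1) * (q : ℤ) := by rw [← pow_succ, Nat.sub_add_cancel hL]
  linear_combination -hw - w * hL'

/-- The diagonal entries of a row `(∗ ∗; N qᵉ k, ∗)`, `e ≥ 1`, are prime to `q`. [folklore] -/
theorem isCoprime_diag (γ : SL(2, ℤ)) {k e : ℕ} (he : 1 ≤ e)
    (hC : (γ : Matrix (Fin 2) (Fin 2) ℤ) 1 0 = ((N * q ^ e * k : ℕ) : ℤ)) :
    IsCoprime ((γ : Matrix (Fin 2) (Fin 2) ℤ) 1 1) (q : ℤ) ∧ IsCoprime ((γ : Matrix (Fin 2) (Fin 2) ℤ) 0 0) (q : ℤ) := by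
  have hdet := γ.prop
  rw [Matrix.det_fin_two] at hdet
  push_cast at hC
  have hq : (q : ℤ) ^ e = (q : ℤ) ^ (e - 1) * (q : ℤ) := by rw [← pow_succ, Nat.sub_add_cancel he]
  refine ⟨⟨(γ : Matrix (Fin 2) (Fin 2) ℤ) 0 0, -((γ : Matrix (Fin 2) (Fin 2) ℤ) 0 1 * (N : ℤ) * (q : ℤ) ^ (e - 1) * (k : ℤ)), ?_⟩,
          ⟨(γ : Matrix (Fin 2) (Fin 2) ℤ) 1 1, -((γ : Matrix (Fin 2) (Fin 2) ℤ) 0 1 * (N : ℤ) * (q : ℤ) ^ (e - 1) * (k : ℤ)), ?_⟩⟩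
  · linear_combination hdet + ((γ : Matrix (Fin 2) (Fin 2) ℤ) 0 1) * hC +
      ((γ : Matrix (Fin 2) (Fin 2) ℤ) 0 1 * (N : ℤ) * (k : ℤ)) * hq
  · linear_combination hdet + ((γ : Matrix (Fin 2) (Fin 2) ℤ) 0 1) * hC +
      ((γ : Matrix (Fin 2) (Fin 2) ℤ) 0 1 * (N : ℤ) * (k : ℤ)) * hq

/-- Euler in `ℤ`: `q^{φ(Nk)·t} ≡ 1 (mod Nk)` for `k` prime to `q` (`q` prime, `q ∤ p·N`). [folklore] -/
theorem pow_totient_mul (hq : q.Prime) (hqpN : ¬ q ∣ p * N) (k : ℕ) (hkq : Nat.Coprime k q) (t : ℕ) :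
    (q : ℤ) ^ (Nat.totient (N * k) * t) ≡ 1 [ZMOD ((N * k : ℕ) : ℤ)] := by
  have hqN : Nat.Coprime q N := (Nat.Prime.coprime_iff_not_dvd hq).mpr (fun h => hqpN (dvd_mul_of_dvd_right h p))
  have hc : Nat.Coprime q (N * k) := Nat.Coprime.mul_right hqN hkq.symm
  have h1 : q ^ (N * k).totient ≡ 1 [MOD (N * k)] := Nat.ModEq.pow_totient hc
  have h2 : q ^ ((N * k).totient * t) ≡ 1 [MOD (N * k)] := by
    rw [pow_mul]; simpa using h1.pow t
  have h3 := Int.natCast_modEq_iff.mpr h2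
  push_cast at h3
  exact h3

/-- Euler in `ℤ` at `k = 1`: `q^{φ(N)·t} ≡ 1 (mod N)`. [folklore] -/
theorem pow_totient_N (hq : q.Prime) (hqpN : ¬ q ∣ p * N) (t : ℕ) :
    (q : ℤ) ^ (Nat.totient N * t) ≡ 1 [ZMOD (N : ℤ)] := by
  simpa [Nat.mul_one] using pow_totient_mul hq hqpN 1 (Nat.coprime_one_left q) t

end Summit.BirchSwinnertonDyer.BirchSwinnertonDyer.Theorems.ManinLocalTwoThree.TVRigidity
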